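import Summits.SmoothPoincare4.SmoothPoincare4.Theses.IsotropicCorkBracketing
import Literature.Geometry.Lorentzian.GreenIdentity
import HarnessLib

/-!
# Route IsotropicCorkBracketing — `NeumannBracketing` (support item stmt-SmoothPoincare4-9828)

Dirichlet–Neumann bracketing, the measure-theoretic half: on a closed smooth 4-manifold `P` with a
smooth Riemannian metric `G`, if closed sets `S₁, S₂` cover `P` and meet in a `dV_G`-null set, and
the isotropic form `u ↦ ∫ (6|∇u|²_G + 3μᵢu²) dV_G` is Neumann-positive on each `Sᵢ` (constants
`cᵢ > 0`, continuous lower bounds `μᵢ` of the isotropic curvatures), then it is positive on `P`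
with `c = min(c₁, c₂)` and `μ = max(μ₁, μ₂)`.

Proof: for `u ∈ C¹(P)` the integrand is continuous — `|∇u|²_G = G⁻¹(du, du)` is continuous by
`continuous_innerDual_mvfderiv` (`Literature/Geometry/Lorentzian/ChartLaplacian.lean`) — hence
integrable for the finite Riemannian measure of the compact `P` (`isFiniteMeasure_riemannianMeasure`,
`integrable_of_continuous`, `Literature/Geometry/Lorentzian/GreenIdentity.lean`); so
`∫_P = ∫_{S₁} + ∫_{S₂}` (`setIntegral_union₀`: `S₁ ∪ S₂ = P`, `dV_G(S₁ ∩ S₂) = 0`, `S₂` Borel),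
`min(c₁,c₂) ∫_{Sᵢ} u² ≤ cᵢ ∫_{Sᵢ} u²` (`∫_{Sᵢ} u² ≥ 0`), and `μᵢ ≤ max(μ₁,μ₂)` passes under the
integral sign (`setIntegral_mono`). Reed–Simon IV §XIII.15 (bracketing); Chavel 2006 §III.3 and
Federer 1969 §3.2.46 (the Riemannian measure). Everything is proved; no definition, no named fact.
-/

noncomputable section

-- the registered namespace `Summit.SmoothPoincare4.SmoothPoincare4.Theorems` repeats a component
set_option linter.dupNamespace false

open scoped Manifold ContDiff Topology ENNReal
open Set MeasureTheory
open Literature.Geometry.Lorentzian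

namespace Summit.SmoothPoincare4.SmoothPoincare4.Theorems

/-- **Neumann bracketing for the isotropic Yamabe form** (route IsotropicCorkBracketing, support
item stmt-SmoothPoincare4-9828, verbatim): if closed `S₁ ∪ S₂ = P` with `dV_G(S₁ ∩ S₂) = 0` and
`cᵢ ∫_{Sᵢ} u² ≤ ∫_{Sᵢ} (6|∇u|² + 3μᵢu²)` for all `u ∈ C¹(P)` (`μᵢ` continuous lower bounds of the
isotropic curvatures of `G`), then `min(c₁,c₂) ∫_P u² ≤ ∫_P (6|∇u|² + 3 max(μ₁,μ₂) u²)` for all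
`u ∈ C¹(P)`, and `max(μ₁,μ₂)` is again a continuous lower bound of the isotropic curvatures.
Reed–Simon IV, §XIII.15 (Dirichlet–Neumann bracketing), measure-theoretic half. [folklore] -/
theorem neumannBracketing_proof :
    _root_.Summit.SmoothPoincare4.SmoothPoincare4.Theses.IsotropicCorkBracketing.NeumannBracketing := by
  unfold _root_.Summit.SmoothPoincare4.SmoothPoincare4.Theses.IsotropicCorkBracketing.NeumannBracketing
  intro P _ _ _ _ _ _ _ _ G hG _ S₁ S₂ _hS₁ hS₂ hcover hnull h₁ h₂
  obtain ⟨c₁, hc₁, μ₁, hμ₁c, hμ₁le, h₁⟩ := h₁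
  obtain ⟨c₂, hc₂, μ₂, hμ₂c, hμ₂le, h₂⟩ := h₂
  set G₀ := G.toContMDiffRiemannianMetric hG with hG₀
  set ν : Measure P := riemannianMeasure G₀ with hν
  haveI : IsFiniteMeasure ν := isFiniteMeasure_riemannianMeasure G₀
  refine ⟨min c₁ c₂, lt_min hc₁ hc₂, fun x ↦ max (μ₁ x) (μ₂ x), hμ₁c.max hμ₂c,
    fun x e he ↦ max_le (hμ₁le x e he) (hμ₂le x e he), fun u hu ↦ ?_⟩
  -- integrability of all integrands (continuity on the compact `P`, finite measure)
  have huc : Continuous u := hu.continuous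
  have hgc : Continuous (G.gradSq u) := continuous_innerDual_mvfderiv G hu hu
  have hi2 : Integrable (fun x ↦ u x ^ 2) ν := integrable_of_continuous G₀ (huc.pow 2)
  have hiQ : ∀ {m : P → ℝ}, Continuous m →
      Integrable (fun x ↦ 6 * G.gradSq u x + 3 * m x * u x ^ 2) ν := fun hm ↦
    integrable_of_continuous G₀
      ((continuous_const.mul hgc).add ((continuous_const.mul hm).mul (huc.pow 2)))
  have hmaxc : Continuous fun x ↦ max (μ₁ x) (μ₂ x) := hμ₁c.max hμ₂c
  -- `∫_P = ∫_{S₁} + ∫_{S₂}` for integrable functions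
  have hdisj : AEDisjoint ν S₁ S₂ := hnull
  have hsplit : ∀ {f : P → ℝ}, Integrable f ν →
      ∫ x, f x ∂ν = ∫ x in S₁, f x ∂ν + ∫ x in S₂, f x ∂ν := by
    intro f hf
    rw [← setIntegral_union₀ hdisj hS₂.measurableSet.nullMeasurableSet hf.integrableOn
      hf.integrableOn, hcover, Measure.restrict_univ]
  -- `μᵢ ≤ max(μ₁, μ₂)` under the integral sign
  have hm₁ : ∫ x in S₁, (6 * G.gradSq u x + 3 * μ₁ x * u x ^ 2) ∂ν ≤
      ∫ x in S₁, (6 * G.gradSq u x + 3 * max (μ₁ x) (μ₂ x) * u x ^ 2) ∂ν :=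
    setIntegral_mono (hiQ hμ₁c).integrableOn (hiQ hmaxc).integrableOn fun x ↦ by
      have h := le_max_left (μ₁ x) (μ₂ x)
      dsimp only
      nlinarith [sq_nonneg (u x)]
  have hm₂ : ∫ x in S₂, (6 * G.gradSq u x + 3 * μ₂ x * u x ^ 2) ∂ν ≤
      ∫ x in S₂, (6 * G.gradSq u x + 3 * max (μ₁ x) (μ₂ x) * u x ^ 2) ∂ν :=
    setIntegral_mono (hiQ hμ₂c).integrableOn (hiQ hmaxc).integrableOn fun x ↦ by
      have h := le_max_right (μ₁ x) (μ₂ x)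
      dsimp only
      nlinarith [sq_nonneg (u x)]
  -- `min(c₁, c₂) ∫_{Sᵢ} u² ≤ cᵢ ∫_{Sᵢ} u²`
  have h0₁ : 0 ≤ ∫ x in S₁, u x ^ 2 ∂ν := integral_nonneg fun x ↦ sq_nonneg (u x)
  have h0₂ : 0 ≤ ∫ x in S₂, u x ^ 2 ∂ν := integral_nonneg fun x ↦ sq_nonneg (u x)
  have hk₁ := mul_le_mul_of_nonneg_right (min_le_left c₁ c₂) h0₁
  have hk₂ := mul_le_mul_of_nonneg_right (min_le_right c₁ c₂) h0₂
  have hI₁ := h₁ u hu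
  have hI₂ := h₂ u hu
  rw [hsplit hi2, hsplit (hiQ hmaxc), mul_add]
  linarith

end Summit.SmoothPoincare4.SmoothPoincare4.Theorems

end
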